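/-
Origin: expansion seat `planner-pub-hodgecm-mc-theta-3-g3-0`, handover #8 2026-08-19T01:27Z md5 bf7c2d2b5456b6da7c012e048c5e84fd (NEW additive leaf, 137 l.; ns HodgeCM.Model (+ .ArchKTypeData); imports HodgeCM.Model.ArchKType (#5) only; INSTALL AFTER #5 (independent of #6/#7); RIGIDITY of E-R9's binder `C`: schwartzEvalₗ (point evaluation on 𝓢 as a linear functional), ArchKTypeData.self_mem_thinCosetK, .arch_apply_basePoint_eq, .exists_omega_apply_ne (any C : ArchKTy (`HOME/mc/pub-hodgecm-mc-theta-3-g3/lean/stage/HodgeCM/Model/ArchKTypeRigidity.lean`, md5 bf7c2d2b, 137 lines);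
landed by the gen-9 packager (p-g9) in gate run 33 as `HodgeCM/Model/ArchKTypeRigidity.lean` (verbatim).
-/
/-
Copyright (c) 2026. Released under Apache 2.0 license as described in the file LICENSE.
Cell pub-hodgecm, MODEL layer (construction prover mc-theta-3, gen 3), node T3-classPacks / E binder `C`:
RIGIDITY of the archimedean `K`-type socket.
-/
import Summits.HodgeConjecture.HodgeCM.Model.ArchKType

/-!
# The archimedean `K`-type socket forces a NON-TRIVIAL Weil action

Revision R9 of the `E` term (`Model/E2InstanceR9`, binder `C`) asks, over the PINNED theta-space input
`X := Model.thetaSpaceInputOf … S V c` (`Model/ThetaSpaceInputPin`), for archimedean `K`-type data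
`C : ArchKTypeData X k N` (`Model/ArchKType`) at every positive level `N`, relative to the adelic side
`S : ThetaAdelicSide V c` (the Weil pair data `P k` — a free DATA binder).  The sanity question (referee 3, #166;
sanity lane SAN-10) is whether `C` is CHEAP once `S` is chosen degenerately, e.g. with the trivial Weil action
`(P k).ω := 1`.

This file proves in the kernel, citing nothing, that it is not: from ANY `C : ArchKTypeData X k N` (`N ≠ 0`) over ANY
theta-space input `X` whose classical weight `τ₁` has no non-zero invariant vector, the Weil action `(X.P k).ω`
moves some member `φ_N(Φ_∞(ℓ))` of the supplied family under some element `ι_∞(κ₁ u)`, `u ∈ K₁` — in particular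
`ω` is not trivial on `ι_∞(K₁) × 1` (`ArchKTypeData.exists_omega_apply_ne`, `ArchKTypeData.omega_ne_one`).

The mechanism (three lines of mathematics): if `ω (ι_∞ κ₁ u, 1)` fixed every `φ_N(Φ_∞(ℓ)) = Φ_∞(ℓ) ⊗ 1_{x₀+N𝒪̂}`,
then by (W-⊗′) `prodN` and (W-K∞′) `harm` the test functions of `Φ_∞(τ₁^∨(u) ℓ)` and `Φ_∞(ℓ)` agree; evaluating
at the principal adelic point of the base point `x₀` (`testFun_ratPt`; `x₀ ∈ x₀ + N𝒪̂`) the linear functional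
`ℓ ↦ Φ_∞(ℓ)(x₀)` on `W^∨` is `τ₁^∨`-invariant, i.e. (reflexivity of `W`) it is the evaluation at a `τ₁`-INVARIANT
vector `w ∈ W`, hence `w = 0`; but its value at `ℓ₀` is `Φ_∞(x₀) ≠ 0` (`arch₀`, `WeilPairData.hx₀`).

Over the pin, `K₁ = Stab(x₀) ⊇ U(2) × U(1)` and `τ₁ = weightOf x₀` is the isotropy representation on the cotangent
plane `ℂ²`, which has no invariant line; so an inhabitant of E's binder `C` can only exist over pair data `S` whose
Weil action restricts NON-trivially to the archimedean stabiliser — the honest (W2)/(W3) content (Schrödinger model,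
harmonic `K_∞`-types) cannot be bypassed by a degenerate `S`.  (The hypothesis on `τ₁` is kept abstract here; its
instance for `weightOf x₀` belongs with the `Stab(x₀) = U(2) × U(1)` / `𝔭₋` tree rows of the theta-2 lane.)

No `structure`/`def … : Prop` packaging, no cited fact; PerL / QW8 / the 2001 programme are not used.
-/

noncomputable section

open Literature.NumberTheory.Automorphic Literature.NumberTheory.Weil1964
open HodgeCM.PerL34.RationalCoset
open HodgeCM.Model.SupplyInstance HodgeCM.Model.SupplyResidual
open scoped Classical SchwartzMap

namespace HodgeCM
namespace Model

open NumberField NumberField.mixedEmbedding IsDedekindDomain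

/-! ### § 0. Point evaluation on the archimedean Schwartz space, as a linear functional -/

section Eval

variable (K : Type) [Field K] [NumberField K] (J : Type) [Fintype J]

/-- `Φ ↦ Φ(x)` on `𝒮((J → K_∞), ℂ)` as a `ℂ`-linear functional. -/
def schwartzEvalₗ (x : J → mixedSpace K) : 𝓢((J → mixedSpace K), ℂ) →ₗ[ℂ] ℂ where
  toFun Φ := Φ x
  map_add' _ _ := rfl
  map_smul' _ _ := rfl

/-- (Ported verbatim from the HodgeCMPerL package; no docstring in the source.) -/
@[simp] theorem schwartzEvalₗ_apply (x : J → mixedSpace K) (Φ : 𝓢((J → mixedSpace K), ℂ)) :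
    schwartzEvalₗ K J x Φ = Φ x := rfl

end Eval

variable {U : Universe} {Lc : CMField} {ι₁ : Lc →+* ℂ} {V : HermSpace3 Lc ι₁} {c : SeesawCtx Lc}
variable {X : ThetaSpaceInput U V c} {k : Fin 4} {N : ℕ}

namespace ArchKTypeData

attribute [local instance] ratModule

variable (C : ArchKTypeData X k N)

/-- The base point lies in its own thin coset: `x₀ ∈ x₀ + N L̂`. -/
theorem self_mem_thinCosetK (x₀ : X.J → X.K) (N : ℕ) :
    x₀ ∈ thinCosetK (finEmb X.K X.J) (intLattice X.K X.J) x₀ N :=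
  (mem_thinCosetK _ _ x₀ x₀ N).2 ⟨0, Submodule.zero_mem _, by rw [smul_zero, add_zero]⟩

/-- **Evaluation at the base point along the family.**  If `ω (ι_∞ κ₁ u, 1)` fixes `φ_N(Φ_∞(ℓ))`, then
`Φ_∞(τ₁^∨(u) ℓ)(x₀) = Φ_∞(ℓ)(x₀)`. -/
theorem arch_apply_basePoint_eq (hN : N ≠ 0) (u : X.K₁) (ℓ : Module.Dual ℂ X.W)
    (h : (X.P k).ω (X.ιinf C.Γ₀ (X.κ₁ u), 1) (C.Φfam ℓ) = C.Φfam ℓ) :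
    C.Φarch (X.τ₁.dual u ℓ) (archEmb X.K X.J (X.P k).x₀) = C.Φarch ℓ (archEmb X.K X.J (X.P k).x₀) := by
  rw [Φfam_apply, C.prodN, C.harm] at h
  have h2 := congrArg
    (fun F : piSchwartzBruhat X.K X.J =>
      (F : (X.J → AdeleRing (𝓞 X.K) X.K) → ℂ) (ratPt X.K X.J (X.P k).x₀)) h
  simpa only [testFun_ratPt _ _ _ _ hN, Set.indicator_of_mem (self_mem_thinCosetK _ _)] using h2

/-- **The socket forces a non-trivial Weil action** (abstract form).  Over a theta-space input whose classical
weight `τ₁` has no non-zero invariant vector, any archimedean `K`-type data at a positive level exhibits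
`u ∈ K₁` and `ℓ ∈ W^∨` with `ω (ι_∞ κ₁ u, 1) φ_N(Φ_∞(ℓ)) ≠ φ_N(Φ_∞(ℓ))`. -/
theorem exists_omega_apply_ne (hN : N ≠ 0) (hτ : ∀ w : X.W, (∀ u : X.K₁, X.τ₁ u w = w) → w = 0) :
    ∃ (u : X.K₁) (ℓ : Module.Dual ℂ X.W),
      (X.P k).ω (X.ιinf C.Γ₀ (X.κ₁ u), 1) (C.Φfam ℓ) ≠ C.Φfam ℓ := by
  by_contra! h
  -- the point evaluation at `x₀` along the family, a linear functional on `W^∨`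
  let φ : Module.Dual ℂ (Module.Dual ℂ X.W) :=
    schwartzEvalₗ X.K X.J (archEmb X.K X.J (X.P k).x₀) ∘ₗ C.Φarch
  have hφ : ∀ (u : X.K₁) (ℓ : Module.Dual ℂ X.W), φ (X.τ₁.dual u ℓ) = φ ℓ := fun u ℓ =>
    C.arch_apply_basePoint_eq hN u ℓ (h u ℓ)
  -- by reflexivity `φ` is the evaluation at a vector `w ∈ W`, which is then `τ₁`-invariant
  obtain ⟨w, hw⟩ : ∃ w : X.W, Module.Dual.eval ℂ X.W w = φ :=
    ⟨(Module.evalEquiv ℂ X.W).symm φ, (Module.evalEquiv ℂ X.W).apply_symm_apply φ⟩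
  have hwinv : ∀ u : X.K₁, X.τ₁ u w = w := by
    intro u
    rw [← sub_eq_zero, ← (Module.forall_dual_apply_eq_zero_iff ℂ _)]
    intro ℓ
    have h1 := hφ u⁻¹ ℓ
    rw [← hw, Module.Dual.eval_apply, Module.Dual.eval_apply, Representation.dual_apply, inv_inv,
      Module.Dual.transpose_apply, LinearMap.comp_apply] at h1
    rw [map_sub, sub_eq_zero, h1]
  have hw0 : w = 0 := hτ w hwinv
  -- but `φ ℓ₀ = Φ_∞(x₀) ≠ 0`
  have hφ0 : φ C.ℓ₀ = 0 := by rw [← hw, hw0, map_zero, LinearMap.zero_apply]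
  exact (X.P k).hx₀ (by simpa [φ, C.arch₀] using hφ0)

/-- **Corollary: the Weil action is not trivial on `ι_∞(K₁) × 1`.** -/
theorem omega_ne_one (hN : N ≠ 0) (hτ : ∀ w : X.W, (∀ u : X.K₁, X.τ₁ u w = w) → w = 0) :
    ∃ u : X.K₁, (X.P k).ω (X.ιinf C.Γ₀ (X.κ₁ u), 1) ≠ 1 := by
  obtain ⟨u, ℓ, h⟩ := C.exists_omega_apply_ne hN hτ
  exact ⟨u, fun h1 => h (by rw [h1]; rfl)⟩

/-- In particular no archimedean `K`-type data exists over pair data with the TRIVIAL Weil action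
(`τ₁` without invariant vectors, `N ≠ 0`). -/
theorem isEmpty_of_omega_eq_one (hN : N ≠ 0) (hτ : ∀ w : X.W, (∀ u : X.K₁, X.τ₁ u w = w) → w = 0)
    (hω : (X.P k).ω = 1) : IsEmpty (ArchKTypeData X k N) :=
  ⟨fun C => by
    obtain ⟨u, h⟩ := C.omega_ne_one hN hτ
    exact h (by rw [hω]; rfl)⟩

end ArchKTypeData

end Model
end HodgeCM
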